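import Summits.QuantumFields.QCD.Theses.PauliWegnerSea
import Summits.QuantumFields.QCD.Theorems.TiltedFlatness.Negative.TwoWellFloor
import Literature.MathematicalPhysics.QuantumFieldTheory.StrongCouplingActivities

/-!
# `TiltedFlatness` (stmt-QuantumFields-14070): the crux reduces to β = 0 relative small balls + the sandwich

Common trunk of the crux idea cards `Ideas/torus-word-abelianisation.md` and
`Ideas/cayley-chart-averaging.md` (crux-ideate round 1, ideator 3), PROVED (0 sorry, standard axioms):

* `flatness_and_smallBalls_of_anticoncentration` — abstract: on a compact space, a density bound
  `w ≤ K·Z` for the weight and relative small balls `μ{F ≤ εF(x₀)} ≤ C_R ε^c` for the amplitude give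
  (a) `F(x₀) ≤ 2(2KC_R+1)^{1/c}·M` and (b) `∫1{F ≤ εM}w/Z ≤ K C_R ε^c` — NO local Remez lemma;
* `tiltedFlatness_of_R1_density : HaarRelativeSmallBalls → TiltDensityBound → TiltedFlatness` —
  the route decl itself (rev 4 = C′), with `C = max(2(2C_DC_R+1)^{1/c}, C_DC_R)`, `p = max(p₀⁺/c, p₀⁺)`;
* `haarAverageTranslate_holds` — `∫ f dHaar = ∫∫ f(g·h) dμ(h) dHaar(g)` for any probability `μ`
  (the Jacobian-free averaging identity both cards fibre/chart Haar measure with).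

Also the (unproved) first-lemma signatures of card torus-word-abelianisation: `NegMomentCircle` (E1),
`NegMomentTorus` (E2), `SU3SurjectiveWord`.  A crux-plan skeleton for either card imports this file and
supplies `stub_R1 : HaarRelativeSmallBalls`, `stub_density : TiltDensityBound`.
-/

namespace Summit.QuantumFields.QCD.Cruxes.TiltedFlatness.R1DensityReduction

open scoped BigOperators Real Matrix.Norms.L2Operator
open MeasureTheory Set Filter
open Literature.MathematicalPhysics.QuantumFieldTheory Literature.MathematicalPhysics.QuantumLattice
  Literature.Probability.LatticeModels
open Summit.QuantumFields.QCD.Theses.PauliWegnerSea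

/-! ## §A  torus-word abelianisation -/

/-- (R1) GLOBAL RELATIVE SMALL BALLS under the untilted product Haar law, uniformly in masses,
volume, outside and sites: `Haar{F ≤ ε F(W₀)} ≤ C ε^c` for every `W₀` with `F(W₀) > 0` (in particular
the argmax when `F ≢ 0`; if `F ≡ 0` on the fibre then `M = 0`, clause (b′) is guarded and (a) is `0 ≤ 0`).
This is the only genuinely analytic input of the crux (see `CruxOfR1Density`). -/
def HaarRelativeSmallBalls : Prop :=
  ∀ Nf : ℕ, ∃ C c : ℝ, 0 < C ∧ 0 < c ∧ ∀ mq : Fin Nf → ℝ, (∀ f, -2 ≤ mq f ∧ mq f ≤ 2) →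
    ∀ (L : ℕ) [NeZero L], 4 ≤ L →
    ∀ (U : GaugeConfig 4 L (Matrix.specialUnitaryGroup (Fin 3) ℂ)) (x y : TorusSite 4 L),
    let star : Edge 4 L → Prop := fun e => e.1 = x ∨ Site.shift e.1 e.2 = x ∨ e.1 = y ∨ Site.shift e.1 e.2 = y
    let refit : GaugeConfig 4 L (Matrix.specialUnitaryGroup (Fin 3) ℂ) →
        GaugeConfig 4 L (Matrix.specialUnitaryGroup (Fin 3) ℂ) := fun W e => if star e then W e else U e
    let F : GaugeConfig 4 L (Matrix.specialUnitaryGroup (Fin 3) ℂ) → ℝ :=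
      fun W => ‖(diracMatrix (refit W) mq).det‖
    let haar : Measure (GaugeConfig 4 L (Matrix.specialUnitaryGroup (Fin 3) ℂ)) :=
      Measure.pi fun _ => haarProbability (Matrix.specialUnitaryGroup (Fin 3) ℂ)
    ∀ (W₀ : GaugeConfig 4 L (Matrix.specialUnitaryGroup (Fin 3) ℂ)), 0 < F W₀ → ∀ ε : ℝ, 0 < ε →
      (haar {W | F W ≤ ε * F W₀}).toReal ≤ C * ε ^ c

/-- TILT DENSITY BOUND (the Lipschitz/Taylor sandwich; not this card's lever): the star-conditional
Wilson law has density `wt/Z ≤ C (1+β)^p` against product Haar, uniformly in the outside. -/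
def TiltDensityBound : Prop :=
  ∃ C p : ℝ, 0 < C ∧ ∀ β : ℝ, 0 ≤ β → ∀ (L : ℕ) [NeZero L], 4 ≤ L →
    ∀ (U : GaugeConfig 4 L (Matrix.specialUnitaryGroup (Fin 3) ℂ)) (x y : TorusSite 4 L),
    let star : Edge 4 L → Prop := fun e => e.1 = x ∨ Site.shift e.1 e.2 = x ∨ e.1 = y ∨ Site.shift e.1 e.2 = y
    let refit : GaugeConfig 4 L (Matrix.specialUnitaryGroup (Fin 3) ℂ) →
        GaugeConfig 4 L (Matrix.specialUnitaryGroup (Fin 3) ℂ) := fun W e => if star e then W e else U e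
    let wt : GaugeConfig 4 L (Matrix.specialUnitaryGroup (Fin 3) ℂ) → ℝ :=
      fun W => Real.exp (-(β * wilsonAction (fundamentalRep (Fin 3)) (refit W)))
    let haar : Measure (GaugeConfig 4 L (Matrix.specialUnitaryGroup (Fin 3) ℂ)) :=
      Measure.pi fun _ => haarProbability (Matrix.specialUnitaryGroup (Fin 3) ℂ)
    let Z : ℝ := ∫ W, wt W ∂haar
    ∀ W, wt W / Z ≤ C * (1 + β) ^ p

/-- STRUCTURAL REDUCTION (both clauses): (R1) + density bound ⇒ the crux.  (a) follows because
`M ≥ δ·F(W₀)·(1 − ν_β(F < δ F(W₀)))` and `ν_β(F < δ F(W₀)) ≤ C(1+β)^p · Haar{F ≤ δ F(W₀)} ≤ ½` for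
`δ = c'(1+β)^{-p/c}`; (b′) because `{F ≤ εM} ⊆ {F ≤ ε sup F}`.  No local Remez lemma is needed. -/
def CruxOfR1Density : Prop := HaarRelativeSmallBalls → TiltDensityBound → TiltedFlatness

/-- (E1) ONE-VARIABLE ENGINE (fundamental theorem of algebra + Hölder): for a non-zero complex
polynomial `p` of degree `≤ m` and `0 < c < 1/m`, the negative moment of `|p|` on the unit circle
relative to ANY of its values on the circle is bounded by a constant depending on `(m, c)` only:
`∫₀^{2π} (|p(e^{iθ₀})| / |p(e^{iθ})|)^c dθ ≤ C(m,c)`  (proof: `p = a∏(z−zᵢ)`,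
`|p(e^{iθ₀})|/|p(e^{iθ})| ≤ ∏ᵢ 3/ min(3,|e^{iθ}−zᵢ|)`-type bound, Hölder with `m` factors,
`sup_z ∫|e^{iθ}−z|^{−cm} dθ < ∞`).  Chebyshev then gives the relative small balls
`|{θ : |p(e^{iθ})| ≤ ε sup|p|}| ≤ C ε^c`, `c = 1/(2m)` admissible. -/
def NegMomentCircle : Prop :=
  ∀ (m : ℕ) (c : ℝ), 0 < c → c * m < 1 → ∃ C : ℝ, ∀ p : Polynomial ℂ, p ≠ 0 → p.natDegree ≤ m →
    ∀ θ₀ : ℝ, ∫ θ in (0 : ℝ)..2 * π,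
      (‖p.eval (Complex.exp (θ₀ * Complex.I))‖ / ‖p.eval (Complex.exp (θ * Complex.I))‖) ^ c ≤ C

/-- (E2) TORUS ITERATE (slice-through-the-argmax Fubini induction on the number of angles): for a
non-zero polynomial `P` in `d` complex variables of degree `≤ m` in EACH variable, restricted to the
torus `|zⱼ| = 1`, and ANY reference point `θ₀`:
`∫_{[0,2π]^d} (|P(e^{iθ₀})| / |P(e^{iθ})|)^c dθ ≤ C(m,c)^d`. -/
def NegMomentTorus : Prop :=
  ∀ (m : ℕ) (c : ℝ), 0 < c → c * m < 1 → ∃ C : ℝ, ∀ (d : ℕ) (P : MvPolynomial (Fin d) ℂ), P ≠ 0 →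
    (∀ j, P.degreeOf j ≤ m) → ∀ θ₀ : Fin d → ℝ,
      ∫ θ in Set.Icc (0 : Fin d → ℝ) (fun _ => 2 * π),
        (‖MvPolynomial.eval (fun j => Complex.exp (θ₀ j * Complex.I)) P‖ /
          ‖MvPolynomial.eval (fun j => Complex.exp (θ j * Complex.I)) P‖) ^ c ≤ C ^ d

/-- SURJECTIVE INTEGER-SPECTRUM WORD (Givens/Euler for `SU(3)`): finitely many one-parameter
subgroups `t ↦ exp(t Xⱼ)` of `SU(3)` whose matrix entries are trigonometric polynomials of degree
`≤ 2` in `t` (⇔ `spec Xⱼ ⊂ i{−2,…,2}`), such that EVERY `g ∈ SU(3)` is an ordered product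
`exp(θ₁X₁)⋯exp(θ_dX_d)`.  (E.g. `d = 8`: the generalized Euler angles
`e^{iαλ₃}e^{iβλ₂}e^{iγλ₃}e^{iθλ₅}e^{iaλ₃}e^{ibλ₂}e^{icλ₃}e^{iφ√3λ₈}`; or a Givens elimination word.) -/
def SU3SurjectiveWord : Prop :=
  ∃ (d : ℕ) (X : Fin d → Matrix (Fin 3) (Fin 3) ℂ),
    (∀ j, ∀ t : ℝ, NormedSpace.exp ((t : ℂ) • X j) ∈ Matrix.specialUnitaryGroup (Fin 3) ℂ) ∧
    (∀ j, ∃ A : Fin 5 → Matrix (Fin 3) (Fin 3) ℂ, ∀ t : ℝ,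
      NormedSpace.exp ((t : ℂ) • X j) =
        ∑ n : Fin 5, Complex.exp ((((n : ℕ) : ℝ) - 2 : ℝ) * t * Complex.I) • A n) ∧
    ∀ g : Matrix.specialUnitaryGroup (Fin 3) ℂ, ∃ θ : Fin d → ℝ,
      (g : Matrix (Fin 3) (Fin 3) ℂ) = (List.ofFn fun j => NormedSpace.exp ((θ j : ℂ) • X j)).prod

/-- EXACT AVERAGING IDENTITY `Haar = Haar ∗ μ` (right-invariance + Fubini; no Jacobian, no Weyl
formula): for ANY probability measure `μ` on a compact group and continuous `f`,
`∫ f dHaar = ∫ (∫ f(g·h) dμ(h)) dHaar(g)`.  Applied with `μ` = law of the word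
`exp(θ₁X₁)⋯exp(θ_dX_d)`, `θ ∼` Lebesgue on `[0,2π]^d`: every fibre `g·(word image) = G` sees the
GLOBAL supremum of `F`, and `F`, `wilsonAction` restricted to a fibre are trigonometric polynomials. -/
def HaarAverageTranslate : Prop :=
  ∀ (G : Type*) [Group G] [TopologicalSpace G] [IsTopologicalGroup G] [CompactSpace G]
    [SecondCountableTopology G] [MeasurableSpace G] [BorelSpace G] (μ : Measure G)
    [IsProbabilityMeasure μ] (f : G → ℝ),
    Continuous f →
      ∫ g, f g ∂(haarProbability G) = ∫ g, (∫ h, f (g * h) ∂μ) ∂(haarProbability G)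

/-- `HaarAverageTranslate` PROVED (Fubini + right invariance of the Haar probability of a compact
group, `haarProbability.instIsMulRightInvariant` of `StrongCouplingActivities`): the exact averaging
identity behind both cards needs no Jacobian and no Weyl integration formula. -/
theorem haarAverageTranslate_holds : HaarAverageTranslate := by
  intro G _ _ _ _ _ _ _ μ _ f hf
  obtain ⟨C, hC⟩ : ∃ C, ∀ x, ‖f x‖ ≤ C := by
    obtain ⟨C, hC⟩ := isCompact_univ.exists_bound_of_continuousOn (f := f) hf.continuousOn
    exact ⟨C, fun x => hC x (Set.mem_univ x)⟩
  have hcont : Continuous (fun p : G × G => f (p.1 * p.2)) := hf.comp continuous_mul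
  have hint : Integrable (Function.uncurry fun g h => f (g * h)) ((haarProbability G).prod μ) := by
    refine Integrable.mono' (integrable_const C) hcont.aestronglyMeasurable ?_
    exact Filter.Eventually.of_forall fun p => hC _
  calc ∫ g, f g ∂(haarProbability G)
      = ∫ h, (∫ g, f g ∂(haarProbability G)) ∂μ := by simp
    _ = ∫ h, (∫ g, f (g * h) ∂(haarProbability G)) ∂μ := by
        congr 1; ext h; exact (integral_mul_right_eq_self f h).symm
    _ = ∫ g, (∫ h, f (g * h) ∂μ) ∂(haarProbability G) := (integral_integral_swap hint).symm

/-- ABSTRACT FORM OF `CruxOfR1Density`, PROVED: on a compact space with a finite measure `μ`, a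
continuous amplitude `F ≥ 0`, a continuous positive weight `w` with DENSITY BOUND `w/Z ≤ K`
(`Z = ∫ w`), and RELATIVE SMALL BALLS `μ{F ≤ ε F(x₀)} ≤ C_R ε^c` for every `x₀` with `F(x₀) > 0`:
(a) `F(x₀) ≤ 2(2KC_R+1)^{1/c} · M` for every `x₀`, `M = ∫Fw/Z` (flatness WITHOUT any local Remez
lemma), and (b) `∫ 1{F ≤ εM} w / Z ≤ K C_R ε^c`.  With `K = C_D(1+β)^{p₀}` this is the crux with
`p = max(p₀/c, p₀)`. -/
theorem flatness_and_smallBalls_of_anticoncentration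
    {X : Type*} [TopologicalSpace X] [CompactSpace X] [MeasurableSpace X] [OpensMeasurableSpace X]
    (μ : Measure X) [IsFiniteMeasure μ] {F w : X → ℝ} (hF : Continuous F) (hw : Continuous w)
    (hF0 : ∀ x, 0 ≤ F x) (hw0 : ∀ x, 0 ≤ w x) {K C_R c : ℝ} (hK : 0 ≤ K) (hCR : 0 ≤ C_R) (hc : 0 < c)
    (hZ : 0 < ∫ y, w y ∂μ) (hdens : ∀ x, w x ≤ K * ∫ y, w y ∂μ)
    (hR1 : ∀ x₀, 0 < F x₀ → ∀ ε : ℝ, 0 < ε → (μ {x | F x ≤ ε * F x₀}).toReal ≤ C_R * ε ^ c) :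
    (∀ x₀, F x₀ ≤ 2 * (2 * K * C_R + 1) ^ (1 / c) * ((∫ x, F x * w x ∂μ) / ∫ y, w y ∂μ)) ∧
    (0 < (∫ x, F x * w x ∂μ) / (∫ y, w y ∂μ) → ∀ ε : ℝ, 0 < ε →
      (∫ x, (if F x ≤ ε * ((∫ x, F x * w x ∂μ) / ∫ y, w y ∂μ) then (1 : ℝ) else 0) * w x ∂μ) /
          (∫ y, w y ∂μ) ≤ K * C_R * ε ^ c) := by
  set Z : ℝ := ∫ y, w y ∂μ with hZdef
  have hwi : Integrable w μ := Summit.QuantumFields.QCD.Theorems.TiltedFlatnessNegative.integrable_of_continuous hw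
  have hFwi : Integrable (fun x => F x * w x) μ :=
    Summit.QuantumFields.QCD.Theorems.TiltedFlatnessNegative.integrable_of_continuous (hF.mul hw)
  -- the weighted mass of a closed sublevel set `{F ≤ t}` is at most `K Z μ{F ≤ t}`
  have hmass : ∀ t : ℝ, ∫ x in {x | F x ≤ t}, w x ∂μ ≤ K * Z * (μ {x | F x ≤ t}).toReal := by
    intro t
    have hmeas : MeasurableSet {x | F x ≤ t} := (isClosed_le hF continuous_const).measurableSet
    calc ∫ x in {x | F x ≤ t}, w x ∂μ ≤ ∫ x in {x | F x ≤ t}, K * Z ∂μ := by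
          refine setIntegral_mono_on hwi.integrableOn (integrableOn_const) hmeas fun x _ => ?_
          exact hdens x
      _ = K * Z * (μ {x | F x ≤ t}).toReal := by
          rw [setIntegral_const, smul_eq_mul, mul_comm]; rfl
  by_cases hX : Nonempty X
  swap
  · haveI : IsEmpty X := not_nonempty_iff.mp hX
    refine ⟨fun x₀ => (IsEmpty.false x₀).elim, fun hM ε hε => ?_⟩
    simp [integral_of_isEmpty] at hM
  obtain ⟨xm, -, hxm⟩ := isCompact_univ.exists_isMaxOn univ_nonempty hF.continuousOn
  have hFmax : ∀ x, F x ≤ F xm := fun x => hxm (mem_univ x)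
  -- `M ≤ F xm`
  have hM_le : (∫ x, F x * w x ∂μ) / Z ≤ F xm := by
    rw [div_le_iff₀ hZ]
    calc ∫ x, F x * w x ∂μ ≤ ∫ x, F xm * w x ∂μ :=
          integral_mono hFwi (hwi.const_mul _) fun x => mul_le_mul_of_nonneg_right (hFmax x) (hw0 x)
      _ = F xm * Z := by rw [integral_const_mul]
  constructor
  · -- (a) flatness
    intro x₀
    set A : ℝ := 2 * K * C_R + 1 with hA
    have hApos : 0 < A := by positivity
    set δ : ℝ := A ^ (-(1 / c)) with hδ
    have hδpos : 0 < δ := Real.rpow_pos_of_pos hApos _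
    have hδc : δ ^ c = A⁻¹ := by
      rw [hδ, ← Real.rpow_mul hApos.le, neg_mul, one_div, inv_mul_cancel₀ hc.ne', Real.rpow_neg hApos.le,
        Real.rpow_one]
    have hinvδ : δ⁻¹ = A ^ (1 / c) := by
      rw [hδ, Real.rpow_neg hApos.le, inv_inv]
    by_cases hFm0 : F xm ≤ 0
    · have h0 : F x₀ = 0 := le_antisymm ((hFmax x₀).trans hFm0) (hF0 x₀)
      rw [h0]
      refine mul_nonneg (by positivity) (div_nonneg (integral_nonneg fun x => ?_) hZ.le)
      exact mul_nonneg (hF0 x) (hw0 x)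
    push Not at hFm0
    -- mass of the deep sublevel set `B = {F ≤ δ F xm}` is at most `K Z C_R δ^c ≤ Z/2`
    set B : Set X := {x | F x ≤ δ * F xm} with hB
    have hBmeas : MeasurableSet B := (isClosed_le hF continuous_const).measurableSet
    have hBmass : ∫ x in B, w x ∂μ ≤ Z / 2 := by
      calc ∫ x in B, w x ∂μ ≤ K * Z * (μ B).toReal := hmass _
        _ ≤ K * Z * (C_R * δ ^ c) := by
            refine mul_le_mul_of_nonneg_left (hR1 xm hFm0 δ hδpos) (by positivity)
        _ = Z * (K * C_R / A) := by rw [hδc]; ring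
        _ ≤ Z * (1 / 2) := by
            refine mul_le_mul_of_nonneg_left ?_ hZ.le
            rw [div_le_iff₀ hApos, hA]; nlinarith [mul_nonneg hK hCR]
        _ = Z / 2 := by ring
    -- lower bound for `∫ F w` on the complement of `B`
    have hlow : δ * F xm * (Z / 2) ≤ ∫ x, F x * w x ∂μ := by
      have hcompl : ∫ x in Bᶜ, w x ∂μ = Z - ∫ x in B, w x ∂μ := setIntegral_compl hBmeas hwi
      have h1 : δ * F xm * (Z / 2) ≤ δ * F xm * ∫ x in Bᶜ, w x ∂μ := by
        refine mul_le_mul_of_nonneg_left ?_ (by positivity)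
        rw [hcompl]; linarith
      have h2 : δ * F xm * ∫ x in Bᶜ, w x ∂μ = ∫ x in Bᶜ, δ * F xm * w x ∂μ := by
        rw [integral_const_mul]
      have h3 : ∫ x in Bᶜ, δ * F xm * w x ∂μ ≤ ∫ x in Bᶜ, F x * w x ∂μ := by
        refine setIntegral_mono_on ((hwi.const_mul _).integrableOn) hFwi.integrableOn hBmeas.compl
          fun x hx => ?_
        have hx' : δ * F xm < F x := by
          simpa [hB] using hx
        exact mul_le_mul_of_nonneg_right hx'.le (hw0 x)
      have h4 : ∫ x in Bᶜ, F x * w x ∂μ ≤ ∫ x, F x * w x ∂μ :=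
        setIntegral_le_integral hFwi (Eventually.of_forall fun x => mul_nonneg (hF0 x) (hw0 x))
      linarith
    -- conclude
    set I : ℝ := ∫ x, F x * w x ∂μ with hI
    have hδne : δ ≠ 0 := hδpos.ne'
    have hZne : Z ≠ 0 := hZ.ne'
    have h1 : F xm * (δ * Z) ≤ I * 2 := by
      have : F xm * (δ * Z) = 2 * (δ * F xm * (Z / 2)) := by ring
      linarith
    have hkey : F xm ≤ 2 * δ⁻¹ * (I / Z) := by
      calc F xm = F xm * (δ * Z) / (δ * Z) := by field_simp
        _ ≤ I * 2 / (δ * Z) := by gcongr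
        _ = 2 * δ⁻¹ * (I / Z) := by field_simp
    calc F x₀ ≤ F xm := hFmax x₀
      _ ≤ 2 * δ⁻¹ * (I / Z) := hkey
      _ = 2 * A ^ (1 / c) * (I / Z) := by rw [hinvδ]
  · -- (b′) relative small balls
    intro hM ε hε
    set M : ℝ := (∫ x, F x * w x ∂μ) / Z with hMdef
    have hFm : 0 < F xm := lt_of_lt_of_le hM hM_le
    have hsub : {x | F x ≤ ε * M} ⊆ {x | F x ≤ ε * F xm} := fun x hx =>
      le_trans (show F x ≤ ε * M from hx) (mul_le_mul_of_nonneg_left hM_le hε.le)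
    have hmeas : MeasurableSet {x | F x ≤ ε * M} := (isClosed_le hF continuous_const).measurableSet
    have hind : ∫ x, (if F x ≤ ε * M then (1 : ℝ) else 0) * w x ∂μ = ∫ x in {x | F x ≤ ε * M}, w x ∂μ := by
      rw [← integral_indicator hmeas]
      congr 1; ext x
      by_cases hx : F x ≤ ε * M
      · simp [hx]
      · simp [hx]
    rw [hind, div_le_iff₀ hZ]
    calc ∫ x in {x | F x ≤ ε * M}, w x ∂μ ≤ K * Z * (μ {x | F x ≤ ε * M}).toReal := hmass _
      _ ≤ K * Z * (μ {x | F x ≤ ε * F xm}).toReal := by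
          refine mul_le_mul_of_nonneg_left ?_ (by positivity)
          exact ENNReal.toReal_mono (measure_ne_top _ _) (measure_mono hsub)
      _ ≤ K * Z * (C_R * ε ^ c) := mul_le_mul_of_nonneg_left (hR1 xm hFm ε hε) (by positivity)
      _ = K * C_R * ε ^ c * Z := by ring

/-- PROVED: the crux `TiltedFlatness` (item 14070, both clauses) follows from
(R1) `HaarRelativeSmallBalls` and the sandwich `TiltDensityBound`, with
`C = max(2(2C_DC_R+1)^{1/c}, C_DC_R)`, `p = max(p₀⁺/c, p₀⁺)`, same `c`. -/
theorem tiltedFlatness_of_R1_density : HaarRelativeSmallBalls → TiltDensityBound → TiltedFlatness := by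
  intro hR1 hD Nf
  obtain ⟨C_R, c, hCR, hc, hR⟩ := hR1 Nf
  obtain ⟨C_D, p₀, hCD, hDD⟩ := hD
  set P : ℝ := max (max p₀ 0 / c) (max p₀ 0) with hP
  set Cbig : ℝ := max (2 * (2 * C_D * C_R + 1) ^ (1 / c)) (C_D * C_R) with hCbig
  refine ⟨Cbig, P, c, lt_max_of_lt_right (mul_pos hCD hCR), hc, ?_⟩
  intro β hβ mq hmq L _ hL U x y star refit F wt haar Z M
  -- continuity of the carriers
  have hrefit : Continuous refit := by
    refine continuous_pi fun e => ?_
    by_cases h : star e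
    · simp only [refit, if_pos h]; exact continuous_apply e
    · simp only [refit, if_neg h]; exact continuous_const
  have hFc : Continuous F :=
    continuous_norm.comp
      (((Summit.QuantumFields.QCD.Theorems.TiltedFlatnessNegative.continuous_diracMatrix mq).comp
        hrefit).matrix_det)
  have hSc : Continuous fun W => wilsonAction (fundamentalRep (Fin 3)) (refit W) :=
    (Summit.QuantumFields.QCD.Theorems.TiltedFlatnessNegative.continuous_wilsonAction
      (fundamentalRep (Fin 3)) (continuous_fundamentalRep (Fin 3))).comp hrefit
  have hwtc : Continuous wt := Real.continuous_exp.comp ((continuous_const.mul hSc).neg)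
  have hF0 : ∀ W, 0 ≤ F W := fun W => norm_nonneg _
  have hwt0 : ∀ W, 0 < wt W := fun W => Real.exp_pos _
  haveI : IsProbabilityMeasure haar := by
    show IsProbabilityMeasure (Measure.pi fun _ => haarProbability (Matrix.specialUnitaryGroup (Fin 3) ℂ))
    infer_instance
  -- `Z > 0`
  have hZ : 0 < Z := by
    obtain ⟨Wm, -, hWm⟩ := isCompact_univ.exists_isMinOn univ_nonempty hwtc.continuousOn
    have hle : ∫ W, wt Wm ∂haar ≤ Z :=
      integral_mono (integrable_const _)
        (Summit.QuantumFields.QCD.Theorems.TiltedFlatnessNegative.integrable_of_continuous hwtc)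
        fun W => hWm (mem_univ W)
    have hc' : ∫ W, wt Wm ∂haar = wt Wm := by simp
    linarith [hwt0 Wm]
  -- density bound and small balls, read off the hypotheses (the `let`s agree definitionally)
  have h1β : (1 : ℝ) ≤ 1 + β := by linarith
  set t : ℝ := (1 + β) ^ (max p₀ 0) with ht
  have ht1 : 1 ≤ t := Real.one_le_rpow h1β (le_max_right _ _)
  have hKle : C_D * (1 + β) ^ p₀ ≤ C_D * t :=
    mul_le_mul_of_nonneg_left (Real.rpow_le_rpow_of_exponent_le h1β (le_max_left _ _)) hCD.le
  have hdens : ∀ W, wt W ≤ C_D * t * Z := by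
    intro W
    have h := hDD β hβ L hL U x y W
    have h' : wt W / Z ≤ C_D * (1 + β) ^ p₀ := h
    rw [div_le_iff₀ hZ] at h'
    exact h'.trans (mul_le_mul_of_nonneg_right hKle hZ.le)
  have hR1' : ∀ W₀, 0 < F W₀ → ∀ ε : ℝ, 0 < ε → (haar {W | F W ≤ ε * F W₀}).toReal ≤ C_R * ε ^ c :=
    fun W₀ hW₀ ε hε => hR mq hmq L hL U x y W₀ hW₀ ε hε
  obtain ⟨ha, hb⟩ := flatness_and_smallBalls_of_anticoncentration haar hFc hwtc hF0
    (fun W => (hwt0 W).le) (by positivity : 0 ≤ C_D * t) hCR.le hc hZ hdens hR1'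
  -- constants: `(2 C_D t C_R + 1)^{1/c} ≤ (2 C_D C_R + 1)^{1/c} t^{1/c}` and `t^{1/c}, t ≤ (1+β)^P`
  have hA : 2 * (C_D * t) * C_R + 1 ≤ (2 * C_D * C_R + 1) * t := by nlinarith [mul_pos hCD hCR]
  have htP1 : t ^ (1 / c) ≤ (1 + β) ^ P := by
    rw [ht, ← Real.rpow_mul (by linarith), mul_one_div]
    exact Real.rpow_le_rpow_of_exponent_le h1β (le_max_left _ _)
  have htP2 : t ≤ (1 + β) ^ P := Real.rpow_le_rpow_of_exponent_le h1β (le_max_right _ _)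
  have hM0 : 0 ≤ M := div_nonneg (integral_nonneg fun W => mul_nonneg (hF0 W) (hwt0 W).le) hZ.le
  refine ⟨fun W₀ => (ha W₀).trans ?_, fun hM ε hε => (hb hM ε hε).trans ?_⟩
  · have h2 : (2 * (C_D * t) * C_R + 1) ^ (1 / c) ≤ (2 * C_D * C_R + 1) ^ (1 / c) * (1 + β) ^ P := by
      calc (2 * (C_D * t) * C_R + 1) ^ (1 / c) ≤ ((2 * C_D * C_R + 1) * t) ^ (1 / c) :=
            Real.rpow_le_rpow (by positivity) hA (by positivity)
        _ = (2 * C_D * C_R + 1) ^ (1 / c) * t ^ (1 / c) := Real.mul_rpow (by positivity) (by positivity)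
        _ ≤ (2 * C_D * C_R + 1) ^ (1 / c) * (1 + β) ^ P :=
            mul_le_mul_of_nonneg_left htP1 (by positivity)
    calc 2 * (2 * (C_D * t) * C_R + 1) ^ (1 / c) * M
        ≤ 2 * ((2 * C_D * C_R + 1) ^ (1 / c) * (1 + β) ^ P) * M := by gcongr
      _ = (2 * (2 * C_D * C_R + 1) ^ (1 / c)) * (1 + β) ^ P * M := by ring
      _ ≤ Cbig * (1 + β) ^ P * M := by gcongr; exact le_max_left _ _
  · calc C_D * t * C_R * ε ^ c = (C_D * C_R) * t * ε ^ c := by ring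
      _ ≤ Cbig * (1 + β) ^ P * ε ^ c := by
          gcongr
          · exact le_max_right _ _

/-- `CruxOfR1Density` holds. -/
theorem cruxOfR1Density_holds : CruxOfR1Density := tiltedFlatness_of_R1_density

end Summit.QuantumFields.QCD.Cruxes.TiltedFlatness.R1DensityReduction
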